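import Summits.HubbardSuperconductivity.HubbardSuperconductivity.Theorems.WeakCouplingBCSKlLindhardEnclosureCosRange
import Summits.HubbardSuperconductivity.HubbardSuperconductivity.Theorems.WeakCouplingBCSKlLindhardEnclosureCeilStructural

/-!
# KL-MARGIN-SCAN reader (22) «kernel-lindhard-enclosure» — RECORDS SOUNDNESS, layer 2: band enclosures, shell statuses, same-side cells

Second analytic layer under the rule predicates (after `…CosRange`): (i) the antitonicity GUARDS make the band `−2(α+β) − 4t′αβ` decreasing in
each cosine on the certified ranges, so `bandDnZ aUp bUp / 2^40 ≤ ε ≤ bandUpZ aLo bLo / 2^40` (integer roundings `cdivZ/fdivZ` on the safe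
side); (ii) hence, for admissible `P` and a GUARDED cell inside the root square, the cell data `Params.cell` enclose the true band at `p` and at
`p + q` for every `p` in the cell (`cell_band_mem`, `cell_band_shift_mem`); (iii) the shell `status` flags are sound (`some true` ⇒ `ε < μ`,
`some false` ⇒ `μ ≤ ε`); (iv) therefore on a cell whose two statuses are certified EQUAL the two-shell integrand VANISHES identically, is
integrable there and its cell integral is `0` (`sameSide_ceilValid_zero`) — the content of the restricted rule `SameSideZeroIn` (its one-line
discharge is filed separately once `…CeilRulesInRoot` is in the tree).  Honest framing: elementary real analysis over the landed kernel
definitions; nothing in this file asserts a KL margin at any `t′ ≠ 0`, `K₃`, `U₀`, the window or B1g dominance; a Kohn–Luttinger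
instability statement is not ODLRO and nothing here proves superconductivity in the Hubbard model.  (p1 g25, 2026-08-29.)
-/

noncomputable section

set_option linter.dupNamespace false

namespace Summit.HubbardSuperconductivity.HubbardSuperconductivity.Theorems.KlLindhardEnclosure

open Real Set MeasureTheory Literature.MathematicalPhysics.QuantumLattice
open Summit.HubbardSuperconductivity.HubbardSuperconductivity.Theorems

/-! ## §1 Casts of the parameters -/

/-- `t′` as a real: `tpN/tpD`. -/
theorem Params.cast_tp (P : Params) : ((P.tp : ℚ) : ℝ) = (P.tpN : ℝ) / (P.tpD : ℝ) := by simp [Params.tp]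

/-- `μ` as a real: `muN/muD`. -/
theorem Params.cast_mu (P : Params) : ((P.mu : ℚ) : ℝ) = (P.muN : ℝ) / (P.muD : ℝ) := by simp [Params.mu]

/-- First coordinate of the transfer momentum. -/
theorem Params.qv_apply_zero (P : Params) : P.qv 0 = (P.q1z : ℝ) / (P.U : ℝ) := by
  simp [Params.qv, Params.q1, Params.toQ, PiLp.toLp_apply, Matrix.cons_val_zero]

/-- Second coordinate of the transfer momentum. -/
theorem Params.qv_apply_one (P : Params) : P.qv 1 = (P.q2z : ℝ) / (P.U : ℝ) := by
  simp [Params.qv, Params.q2, Params.toQ, PiLp.toLp_apply, Matrix.cons_val_one, Matrix.cons_val_fin_one]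

/-- The band of the certificate at a momentum, written out. -/
theorem Params.band_apply (P : Params) (p : Momentum) :
    P.band p = -2 * (Real.cos (p 0) + Real.cos (p 1)) - 4 * ((P.tpN : ℝ) / (P.tpD : ℝ)) * Real.cos (p 0) * Real.cos (p 1) := by
  simp only [Params.band, squareDispersion, P.cast_tp]; ring

/-- Facts from admissibility: `0 < tpD`, `0 < muD`, `0 < U`, `|q₁| + Xz ≤ 2·piLoZ`, `|q₂| + Xz ≤ 2·piLoZ`. -/
theorem Params.admissible_facts (P : Params) (hP : P.admissible = true) :
    0 < P.tpD ∧ 0 < P.muD ∧ 0 < P.U ∧ |P.q1z| + P.Xz ≤ 2 * P.piLoZ ∧ |P.q2z| + P.Xz ≤ 2 * P.piLoZ := by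
  simp only [Params.admissible, Bool.and_eq_true, decide_eq_true_eq] at hP
  exact ⟨hP.1.1.1.1.1.1.1.1.1.1, hP.1.1.1.1.1.1.1.1.1.2, hP.1.1.1.1.1.1.2, hP.1.2, hP.2⟩

/-! ## §2 The guards: the band is antitone in each cosine on the certified ranges -/

/-- A guard `−2·D·tpD < 4·tpN·c` as a real inequality: `0 < 2 + 4 t′ (c/2^40)`. -/
theorem Params.guard_real (P : Params) (htpD : 0 < P.tpD) {c : ℤ} (h : P.guard c = true) :
    0 < 2 + 4 * ((P.tpN : ℝ) / (P.tpD : ℝ)) * ((c : ℝ) / 2 ^ 40) := by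
  simp only [Params.guard, D, decide_eq_true_eq] at h
  have h' : -2 * (2 : ℝ) ^ 40 * (P.tpD : ℝ) < 4 * (P.tpN : ℝ) * (c : ℝ) := by exact_mod_cast h
  have htpD' : (0 : ℝ) < (P.tpD : ℝ) := by exact_mod_cast htpD
  have e : 2 + 4 * ((P.tpN : ℝ) / (P.tpD : ℝ)) * ((c : ℝ) / 2 ^ 40)
      = (2 * 2 ^ 40 * (P.tpD : ℝ) + 4 * (P.tpN : ℝ) * (c : ℝ)) / ((P.tpD : ℝ) * 2 ^ 40) := by
    field_simp
  rw [e]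
  exact div_pos (by linarith) (by positivity)

/-- The β-slope stays positive between two guarded range ends. -/
theorem Params.two_add_pos_on (P : Params) (htpD : 0 < P.tpD) {lo hi : ℤ} (hlo : P.guard lo = true) (hhi : P.guard hi = true)
    {β : ℝ} (h1 : (lo : ℝ) / 2 ^ 40 ≤ β) (h2 : β ≤ (hi : ℝ) / 2 ^ 40) :
    0 < 2 + 4 * ((P.tpN : ℝ) / (P.tpD : ℝ)) * β := by
  have g1 := P.guard_real htpD hlo
  have g2 := P.guard_real htpD hhi
  by_cases ht : 0 ≤ (P.tpN : ℝ) / (P.tpD : ℝ)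
  · have : 4 * ((P.tpN : ℝ) / (P.tpD : ℝ)) * ((lo : ℝ) / 2 ^ 40) ≤ 4 * ((P.tpN : ℝ) / (P.tpD : ℝ)) * β :=
      mul_le_mul_of_nonneg_left h1 (by linarith)
    linarith
  · push Not at ht
    have : 4 * ((P.tpN : ℝ) / (P.tpD : ℝ)) * ((hi : ℝ) / 2 ^ 40) ≤ 4 * ((P.tpN : ℝ) / (P.tpD : ℝ)) * β :=
      mul_le_mul_of_nonpos_left h2 (by linarith)
    linarith

/-- **BAND ENCLOSURE FROM THE GUARDS**: with all four range ends guarded and `α ∈ [aLo, aUp]/2^40`, `β ∈ [bLo, bUp]/2^40`,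
`bandDnZ aUp bUp / 2^40 ≤ −2(α+β) − 4t′αβ ≤ bandUpZ aLo bLo / 2^40`. -/
theorem Params.band_enclosure (P : Params) (htpD : 0 < P.tpD) {aLo aUp bLo bUp : ℤ} (g1 : P.guard aLo = true)
    (g2 : P.guard aUp = true) (g3 : P.guard bLo = true) (g4 : P.guard bUp = true) {α β : ℝ}
    (hα1 : (aLo : ℝ) / 2 ^ 40 ≤ α) (hα2 : α ≤ (aUp : ℝ) / 2 ^ 40) (hβ1 : (bLo : ℝ) / 2 ^ 40 ≤ β) (hβ2 : β ≤ (bUp : ℝ) / 2 ^ 40) :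
    ((P.bandDnZ aUp bUp : ℤ) : ℝ) / 2 ^ 40 ≤ -2 * (α + β) - 4 * ((P.tpN : ℝ) / (P.tpD : ℝ)) * α * β ∧
    -2 * (α + β) - 4 * ((P.tpN : ℝ) / (P.tpD : ℝ)) * α * β ≤ ((P.bandUpZ aLo bLo : ℤ) : ℝ) / 2 ^ 40 := by
  set t := (P.tpN : ℝ) / (P.tpD : ℝ) with ht
  have htpD' : (0 : ℝ) < (P.tpD : ℝ) := by exact_mod_cast htpD
  -- slopes
  have sβ : 0 < 2 + 4 * t * β := P.two_add_pos_on htpD g3 g4 hβ1 hβ2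
  have sA : 0 < 2 + 4 * t * ((aUp : ℝ) / 2 ^ 40) := P.guard_real htpD g2
  have sL : 0 < 2 + 4 * t * ((aLo : ℝ) / 2 ^ 40) := P.guard_real htpD g1
  -- monotone comparisons (exact polynomial identities behind them)
  have p1 : 0 ≤ ((aUp : ℝ) / 2 ^ 40 - α) * (2 + 4 * t * β) := mul_nonneg (by linarith) sβ.le
  have p2 : 0 ≤ ((bUp : ℝ) / 2 ^ 40 - β) * (2 + 4 * t * ((aUp : ℝ) / 2 ^ 40)) := mul_nonneg (by linarith) sA.le
  have p3 : 0 ≤ (α - (aLo : ℝ) / 2 ^ 40) * (2 + 4 * t * β) := mul_nonneg (by linarith) sβ.le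
  have p4 : 0 ≤ (β - (bLo : ℝ) / 2 ^ 40) * (2 + 4 * t * ((aLo : ℝ) / 2 ^ 40)) := mul_nonneg (by linarith) sL.le
  have lower : -2 * ((aUp : ℝ) / 2 ^ 40 + (bUp : ℝ) / 2 ^ 40) - 4 * t * ((aUp : ℝ) / 2 ^ 40) * ((bUp : ℝ) / 2 ^ 40)
      ≤ -2 * (α + β) - 4 * t * α * β := by nlinarith [p1, p2]
  have upper : -2 * (α + β) - 4 * t * α * β
      ≤ -2 * ((aLo : ℝ) / 2 ^ 40 + (bLo : ℝ) / 2 ^ 40) - 4 * t * ((aLo : ℝ) / 2 ^ 40) * ((bLo : ℝ) / 2 ^ 40) := by nlinarith [p3, p4]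
  -- integer roundings
  have hD : (0 : ℤ) < D := by rw [D]; norm_num
  have hDpos : 0 < P.tpD * D := mul_pos htpD hD
  have rc : ((4 * P.tpN * aUp * bUp : ℤ) : ℝ) / ((P.tpD * D : ℤ) : ℝ) ≤ ((cdivZ (4 * P.tpN * aUp * bUp) (P.tpD * D) : ℤ) : ℝ) := by
    have h := div_le_cdivZ (4 * P.tpN * aUp * bUp) (P.tpD * D) hDpos
    have := (Rat.cast_le (K := ℝ)).mpr h
    simpa [Rat.cast_div] using this
  have rf : ((fdivZ (4 * P.tpN * aLo * bLo) (P.tpD * D) : ℤ) : ℝ) ≤ ((4 * P.tpN * aLo * bLo : ℤ) : ℝ) / ((P.tpD * D : ℤ) : ℝ) := by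
    have h := fdivZ_le_div (4 * P.tpN * aLo * bLo) (P.tpD * D) hDpos
    have := (Rat.cast_le (K := ℝ)).mpr h
    simpa [Rat.cast_div] using this
  constructor
  · refine le_trans ?_ lower
    have e : -2 * ((aUp : ℝ) / 2 ^ 40 + (bUp : ℝ) / 2 ^ 40) - 4 * t * ((aUp : ℝ) / 2 ^ 40) * ((bUp : ℝ) / 2 ^ 40)
        = (-2 * ((aUp : ℝ) + (bUp : ℝ)) - ((4 * P.tpN * aUp * bUp : ℤ) : ℝ) / ((P.tpD * D : ℤ) : ℝ)) / 2 ^ 40 := by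
      push_cast [D, ht]
      field_simp
      ring
    rw [e]
    apply div_le_div_of_nonneg_right _ (by positivity)
    simp only [Params.bandDnZ]
    push_cast at rc ⊢
    linarith
  · refine le_trans upper ?_
    have e : -2 * ((aLo : ℝ) / 2 ^ 40 + (bLo : ℝ) / 2 ^ 40) - 4 * t * ((aLo : ℝ) / 2 ^ 40) * ((bLo : ℝ) / 2 ^ 40)
        = (-2 * ((aLo : ℝ) + (bLo : ℝ)) - ((4 * P.tpN * aLo * bLo : ℤ) : ℝ) / ((P.tpD * D : ℤ) : ℝ)) / 2 ^ 40 := by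
      push_cast [D, ht]
      field_simp
      ring
    rw [e]
    apply div_le_div_of_nonneg_right _ (by positivity)
    simp only [Params.bandUpZ]
    push_cast at rf ⊢
    linarith

/-! ## §3 The cell data enclose the true band on the cell (guarded cells inside the root square) -/

/-- The guards of a cell, unpacked. -/
theorem Params.cell_guards (P : Params) (x0 x1 y0 y1 : Pt) (hg : (P.cell x0 x1 y0 y1).guards = true) :
    P.guard (P.cell x0 x1 y0 y1).aLo = true ∧ P.guard (P.cell x0 x1 y0 y1).aUp = true ∧
    P.guard (P.cell x0 x1 y0 y1).bLo = true ∧ P.guard (P.cell x0 x1 y0 y1).bUp = true ∧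
    P.guard (P.cell x0 x1 y0 y1).aLo' = true ∧ P.guard (P.cell x0 x1 y0 y1).aUp' = true ∧
    P.guard (P.cell x0 x1 y0 y1).bLo' = true ∧ P.guard (P.cell x0 x1 y0 y1).bUp' = true := by
  simp only [Params.cell, Bool.and_eq_true] at hg ⊢
  obtain ⟨⟨⟨⟨⟨⟨⟨h1, h2⟩, h3⟩, h4⟩, h5⟩, h6⟩, h7⟩, h8⟩ := hg
  exact ⟨h1, h2, h3, h4, h5, h6, h7, h8⟩

/-- **CELL SOUNDNESS at `p`**: for admissible `P`, a guarded cell inside the root square and `p` in the cell,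
`e1Lo/2^40 ≤ ε(p) ≤ e1Hi/2^40`. -/
theorem Params.cell_band_mem (P : Params) (hP : P.admissible = true) {a b c d : ℤ} (ha : -P.Xz ≤ a) (hb : b ≤ P.Xz)
    (hc : -P.Xz ≤ c) (hd : d ≤ P.Xz) (hg : (P.cell (P.mkX a) (P.mkX b) (P.mkY c) (P.mkY d)).guards = true)
    {p : Momentum} (hp : p ∈ P.cellSet a b c d) :
    (((P.cell (P.mkX a) (P.mkX b) (P.mkY c) (P.mkY d)).e1Lo : ℤ) : ℝ) / 2 ^ 40 ≤ P.band p ∧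
    P.band p ≤ (((P.cell (P.mkX a) (P.mkX b) (P.mkY c) (P.mkY d)).e1Hi : ℤ) : ℝ) / 2 ^ 40 := by
  obtain ⟨htpD, -, hU, hq1, hq2⟩ := P.admissible_facts hP
  obtain ⟨g1, g2, g3, g4, -, -, -, -⟩ := P.cell_guards _ _ _ _ hg
  have hq1' := abs_nonneg P.q1z
  have hq2' := abs_nonneg P.q2z
  simp only [Params.cellSet, mem_setOf_eq, P.cast_toQ] at hp
  obtain ⟨h0a, h0b, h1c, h1d⟩ := hp
  -- cosine ranges of the two coordinates
  have αlo := P.cosInfZ_le hP (P.mkX_lo_le hU a) (P.mkX_lo_le hU b) h0a h0b.le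
  have αhi := P.le_cosSupZ hP (P.le_mkX_hi hU a) (P.le_mkX_hi hU b) (by omega) (by omega) h0a h0b.le
  have βlo := P.cosInfZ_le hP (P.mkY_lo_le hU c) (P.mkY_lo_le hU d) h1c h1d.le
  have βhi := P.le_cosSupZ hP (P.le_mkY_hi hU c) (P.le_mkY_hi hU d) (by omega) (by omega) h1c h1d.le
  have key := P.band_enclosure htpD g1 g2 g3 g4 αlo αhi βlo βhi
  rw [P.band_apply]
  simpa [Params.cell, Params.mkX_z, Params.mkY_z] using key

/-- **CELL SOUNDNESS at `p + q`**: same for the shifted point, `e2Lo/2^40 ≤ ε(p+q) ≤ e2Hi/2^40`. -/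
theorem Params.cell_band_shift_mem (P : Params) (hP : P.admissible = true) {a b c d : ℤ} (ha : -P.Xz ≤ a) (hb : b ≤ P.Xz)
    (hc : -P.Xz ≤ c) (hd : d ≤ P.Xz) (hg : (P.cell (P.mkX a) (P.mkX b) (P.mkY c) (P.mkY d)).guards = true)
    {p : Momentum} (hp : p ∈ P.cellSet a b c d) :
    (((P.cell (P.mkX a) (P.mkX b) (P.mkY c) (P.mkY d)).e2Lo : ℤ) : ℝ) / 2 ^ 40 ≤ P.band (p + P.qv) ∧
    P.band (p + P.qv) ≤ (((P.cell (P.mkX a) (P.mkX b) (P.mkY c) (P.mkY d)).e2Hi : ℤ) : ℝ) / 2 ^ 40 := by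
  obtain ⟨htpD, -, hU, hq1, hq2⟩ := P.admissible_facts hP
  obtain ⟨-, -, -, -, g1, g2, g3, g4⟩ := P.cell_guards _ _ _ _ hg
  have hq1a := le_abs_self P.q1z
  have hq1b := neg_abs_le P.q1z
  have hq2a := le_abs_self P.q2z
  have hq2b := neg_abs_le P.q2z
  have hU' : (0 : ℝ) < (P.U : ℝ) := by exact_mod_cast hU
  simp only [Params.cellSet, mem_setOf_eq, P.cast_toQ] at hp
  obtain ⟨h0a, h0b, h1c, h1d⟩ := hp
  have hx0 : ((a + P.q1z : ℤ) : ℝ) / (P.U : ℝ) ≤ (p + P.qv) 0 := by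
    rw [PiLp.add_apply, P.qv_apply_zero]; push_cast; rw [add_div]; linarith
  have hx1 : (p + P.qv) 0 ≤ ((b + P.q1z : ℤ) : ℝ) / (P.U : ℝ) := by
    rw [PiLp.add_apply, P.qv_apply_zero]; push_cast; rw [add_div]; linarith
  have hy0 : ((c + P.q2z : ℤ) : ℝ) / (P.U : ℝ) ≤ (p + P.qv) 1 := by
    rw [PiLp.add_apply, P.qv_apply_one]; push_cast; rw [add_div]; linarith
  have hy1 : (p + P.qv) 1 ≤ ((d + P.q2z : ℤ) : ℝ) / (P.U : ℝ) := by
    rw [PiLp.add_apply, P.qv_apply_one]; push_cast; rw [add_div]; linarith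
  have αlo := P.cosInfZ_le hP (P.mkX_lo'_le hU a) (P.mkX_lo'_le hU b) hx0 hx1
  have αhi := P.le_cosSupZ hP (P.le_mkX_hi' hU a) (P.le_mkX_hi' hU b) (by omega) (by omega) hx0 hx1
  have βlo := P.cosInfZ_le hP (P.mkY_lo'_le hU c) (P.mkY_lo'_le hU d) hy0 hy1
  have βhi := P.le_cosSupZ hP (P.le_mkY_hi' hU c) (P.le_mkY_hi' hU d) (by omega) (by omega) hy0 hy1
  have key := P.band_enclosure htpD g1 g2 g3 g4 αlo αhi βlo βhi
  rw [P.band_apply]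
  simpa [Params.cell, Params.mkX_z, Params.mkY_z] using key

/-! ## §4 Shell statuses are sound -/

/-- `status = some true` certifies `eHi/2^40 < μ`. -/
theorem Params.status_true_lt (P : Params) (hmuD : 0 < P.muD) {eLo eHi : ℤ} (h : P.status eLo eHi = some true) :
    ((eHi : ℤ) : ℝ) / 2 ^ 40 < ((P.mu : ℚ) : ℝ) := by
  unfold Params.status at h
  split_ifs at h with h1 h2
  · simp only [Params.ltMu, D, decide_eq_true_eq] at h1
    have h1' : (eHi : ℝ) * (P.muD : ℝ) < (P.muN : ℝ) * 2 ^ 40 := by exact_mod_cast h1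
    have hmuD' : (0 : ℝ) < (P.muD : ℝ) := by exact_mod_cast hmuD
    rw [P.cast_mu, div_lt_div_iff₀ (by positivity) hmuD']
    linarith
  · simp at h

/-- `status = some false` certifies `μ ≤ eLo/2^40`. -/
theorem Params.status_false_le (P : Params) (hmuD : 0 < P.muD) {eLo eHi : ℤ} (h : P.status eLo eHi = some false) :
    ((P.mu : ℚ) : ℝ) ≤ ((eLo : ℤ) : ℝ) / 2 ^ 40 := by
  unfold Params.status at h
  split_ifs at h with h1 h2
  · simp at h
  · simp only [Params.muLe, D, decide_eq_true_eq] at h2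
    have h2' : (P.muN : ℝ) * 2 ^ 40 ≤ (eLo : ℝ) * (P.muD : ℝ) := by exact_mod_cast h2
    have hmuD' : (0 : ℝ) < (P.muD : ℝ) := by exact_mod_cast hmuD
    rw [P.cast_mu, div_le_div_iff₀ hmuD' (by positivity)]
    linarith

/-! ## §5 Same-side cells carry no mass -/

/-- On a guarded cell inside the root square whose two statuses are certified EQUAL, the two-shell integrand vanishes identically. -/
theorem Params.sameSide_integrand_zero (P : Params) (hP : P.admissible = true) {a b c d : ℤ} (ha : -P.Xz ≤ a) (hb : b ≤ P.Xz)
    (hc : -P.Xz ≤ c) (hd : d ≤ P.Xz) (hg : (P.cell (P.mkX a) (P.mkX b) (P.mkY c) (P.mkY d)).guards = true) (k : Bool)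
    (hs1 : P.status (P.cell (P.mkX a) (P.mkX b) (P.mkY c) (P.mkY d)).e1Lo (P.cell (P.mkX a) (P.mkX b) (P.mkY c) (P.mkY d)).e1Hi = some k)
    (hs2 : P.status (P.cell (P.mkX a) (P.mkX b) (P.mkY c) (P.mkY d)).e2Lo (P.cell (P.mkX a) (P.mkX b) (P.mkY c) (P.mkY d)).e2Hi = some k)
    {p : Momentum} (hp : p ∈ P.cellSet a b c d) : P.integrand p = 0 := by
  obtain ⟨-, hmuD, -, -, -⟩ := P.admissible_facts hP
  obtain ⟨e1l, e1h⟩ := P.cell_band_mem hP ha hb hc hd hg hp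
  obtain ⟨e2l, e2h⟩ := P.cell_band_shift_mem hP ha hb hc hd hg hp
  cases k with
  | true =>
    have h1 : P.band p < ((P.mu : ℚ) : ℝ) := lt_of_le_of_lt e1h (P.status_true_lt hmuD hs1)
    have h2 : P.band (p + P.qv) < ((P.mu : ℚ) : ℝ) := lt_of_le_of_lt e2h (P.status_true_lt hmuD hs2)
    simp [Params.integrand, lindhardIntegrand, fermiOccupation, h1, h2]
  | false =>
    have h1 : ¬ P.band p < ((P.mu : ℚ) : ℝ) := not_lt.mpr ((P.status_false_le hmuD hs1).trans e1l)
    have h2 : ¬ P.band (p + P.qv) < ((P.mu : ℚ) : ℝ) := not_lt.mpr ((P.status_false_le hmuD hs2).trans e2l)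
    simp [Params.integrand, lindhardIntegrand, fermiOccupation, h1, h2]

/-- **SAME-SIDE CELLS CARRY NO MASS** (the content of the restricted rule `SameSideZeroIn`): integrable on the cell and `2^30 ∫_cell F ≤ 0`. -/
theorem Params.sameSide_ceilValid_zero (P : Params) (hP : P.admissible = true) {a b c d : ℤ} (ha : -P.Xz ≤ a) (hb : b ≤ P.Xz)
    (hc : -P.Xz ≤ c) (hd : d ≤ P.Xz) (hg : (P.cell (P.mkX a) (P.mkX b) (P.mkY c) (P.mkY d)).guards = true) (k : Bool)
    (hs1 : P.status (P.cell (P.mkX a) (P.mkX b) (P.mkY c) (P.mkY d)).e1Lo (P.cell (P.mkX a) (P.mkX b) (P.mkY c) (P.mkY d)).e1Hi = some k)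
    (hs2 : P.status (P.cell (P.mkX a) (P.mkX b) (P.mkY c) (P.mkY d)).e2Lo (P.cell (P.mkX a) (P.mkX b) (P.mkY c) (P.mkY d)).e2Hi = some k) :
    IntegrableOn P.integrand (P.cellSet a b c d) volume ∧ 2 ^ 30 * P.cellInt a b c d ≤ ((0 : ℤ) : ℝ) := by
  have hzero : EqOn P.integrand (fun _ => (0 : ℝ)) (P.cellSet a b c d) :=
    fun p hp => P.sameSide_integrand_zero hP ha hb hc hd hg k hs1 hs2 hp
  have hmeas := P.measurableSet_cellSet a b c d
  refine ⟨(integrableOn_congr_fun hzero hmeas).mpr integrableOn_zero, ?_⟩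
  have : P.cellInt a b c d = 0 := by
    unfold Params.cellInt
    rw [setIntegral_congr_fun hmeas hzero]
    simp
  rw [this]; simp

end Summit.HubbardSuperconductivity.HubbardSuperconductivity.Theorems.KlLindhardEnclosure

end
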